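import Summits.NavierStokesRegularity.NavierStokesRegularity.Theorems.ScenarioCensusStripMeter
import Summits.NavierStokesRegularity.NavierStokesRegularity.Theorems.ScenarioCensusSubgridMeterLaws
import HarnessLib

/-!
# LINE «strip-meter» REV 2 port, part 2/2: §G the rows, §H verdicts, §I REV 2 — the QUANTIFIED tube law and the two-sided window (`tube_law_quantified`, rows
# `Row_A2zq` / `Row_A2zw`); census KEYS `Row_A2zp` / `Row_A2z1` / `Row_A2zb` / `Row_A2zg` / `Row_A2zl` / `Row_A2zq` / `Row_A2zw` + `_excluded`, `Row_A2zU` /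
# `Row_A2zE` (OPEN)

Re-homed for the scenario census (typer seat ns-census-typer-1 g9; the cells A2zp / A2z1 / A2zb / A2zg (+ the tube law A2zl) and, by REV 2, A2zq / A2zw are
MEMBERS OF RECORD «DECIDED IN KERNEL IN FILES» of block A2 since census v1.87 / v1.90 (critic idea-crit-3 g8 PASS 05:45:25Z — no price; ref ns-census-ref g11
PRE-CHECK ✓ §16.15 item 53 + REV 2 §16.23; lead-presearch label item 53); this port makes them TREE-decided): VERBATIM PORT of ns-idea-2 «strip-meter» REV 2,
`pub/ideators/ns-idea-2/lines/strip-meter/line-strip-meter.rev2.lean` sha16 26ff2c99d04bd0c0 (550 l. = rev 1 2718956e744490b2 + §I, lean check rc 0, 0 sorry),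
split for the 400-line rule into `ScenarioCensusStripMeter` (§A–§F) → `…StripMeterRows` (§G–§I + census KEYS).  Lean text VERBATIM in namespace
`…Theorems.ScenarioCensus.StripMeter` (the line's `…Lines.StripMeter` re-homed); port edits: `local notation "E3"` / `"E3C"` → `abbrev E3` / `abbrev E3C` (typer
lint: no notation in port files), `@[conjecture]` on the OPEN rows `Row_A2zU` / `Row_A2zE` (typed only), nine one-line docstrings added (gate lint); two numeric
one-liners that restate landed Literature lemmas are not re-declared (their single uses carry the line's own proof inline, proof text only).  Statements
untouched.

No census VALUE is moved here (the cells become TREE-decided by name; booking is the lead's); NS regularity is NOT proved; (L′) ⟨10661⟩ is untouched; no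
summit statement is proved by this file. Lemmas that restate already-landed tree declarations are taken BY NAME (gate lint `dedup.landed`): `eq_zero_of_strain_le_half` = `SubgridMeter.eq_zero_of_strain_le_half`, `eq_zero_of_strain_le_half_before` = `SubgridMeter.eq_zero_of_strain_le_half_before`.
-/

-- the summit and its single problem share the name `NavierStokesRegularity` (D-0017 nested layout)
set_option linter.dupNamespace false

noncomputable section

open Set Function Filter Topology Metric MeasureTheory
open scoped RealInnerProductSpace ENNReal NNReal

namespace Summit.NavierStokesRegularity.NavierStokesRegularity.Theorems.ScenarioCensus.StripMeter

open Literature.Analysis Literature.Analysis.FluidPDE Literature.Analysis.UnboundedOperators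
open Literature.Analysis.FunctionSpaces.EuclideanSpace (complexify complexify_apply norm_complexify)
open Summit.NavierStokesRegularity.NavierStokesRegularity.Theorems
open Summit.NavierStokesRegularity.NavierStokesRegularity.Theorems.SymmetryModuliCountSymmetricLiouville

/-! ## G. Rows -/

/-- Row A2zp · METER READING (pointwise law; PROVED): tube width `(8M+1)√(−t)` at amplitude `M/√(−t)`
certifies `(−t)‖∇u(t,x)‖ ≤ ½`. -/
def Row_A2zp : Prop :=
  ∀ M : ℝ, 0 ≤ M → ∀ (C : ℝ) (u : ℝ → E3 → E3), IsTypeIAncientMild C u → ∀ t < 0,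
    TubeExt (u t) ((8 * M + 1) * Real.sqrt (-t)) (M / Real.sqrt (-t)) →
      ∀ x : E3, (-t) * ‖fderiv ℝ (u t) x‖ ≤ 1 / 2

/-- Row A2z1 · STRIP CELL (PROVED): a singularity model is never analytic in the tube of width
`(8M+1)√(−t)` with complex amplitude `M/√(−t)` at all times. -/
def Row_A2z1 : Prop :=
  ∀ M : ℝ, 0 ≤ M → ∀ (C : ℝ) (u : ℝ → E3 → E3), IsTypeIAncientMild C u →
    (∀ t < 0, TubeExt (u t) ((8 * M + 1) * Real.sqrt (-t)) (M / Real.sqrt (-t))) →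
      ∀ t < 0, ∀ x, u t x = 0

/-- Row A2zb · backward-end version of A2z1 (PROVED). -/
def Row_A2zb : Prop :=
  ∀ M : ℝ, 0 ≤ M → ∀ (C : ℝ) (u : ℝ → E3 → E3), IsTypeIAncientMild C u → ∀ T ≤ (0 : ℝ),
    (∀ t < T, TubeExt (u t) ((8 * M + 1) * Real.sqrt (-t)) (M / Real.sqrt (-t))) →
      ∀ t < 0, ∀ x, u t x = 0

/-- Row A2zg · GAUSSIAN-TYPE CELL (PROVED): entire slices with `‖U(x+iy)‖ ≤ (M/√(−t))·exp(‖y‖²/(4θ(−t)))`,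
`θ = 144M² + 1`, force `u ≡ 0`. -/
def Row_A2zg : Prop :=
  ∀ M : ℝ, 0 ≤ M → ∀ (C : ℝ) (u : ℝ → E3 → E3), IsTypeIAncientMild C u →
    (∀ t < 0, GaussExt (u t) (M / Real.sqrt (-t)) ((144 * M ^ 2 + 1) * (-t))) →
      ∀ t < 0, ∀ x, u t x = 0

/-- Row A2zl · TUBE LAW (PROVED; tree theorem, fields matched): the strip meter is positive on the class. -/
def Row_A2zl : Prop :=
  ∀ (C : ℝ) (u : ℝ → E3 → E3), IsTypeIAncientMild C u → ∀ t < 0, ∃ r : ℝ, 0 < r ∧ ∃ B : ℝ, TubeExt (u t) r B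

/-- Row A2zU · UNIVERSAL WIDTH (OPEN, typed): one number `Λ` of dissipation lengths of analyticity, carrying
the CLASS amplitude `C/√(−t)`, forces triviality for every `C`. -/
@[conjecture] def Row_A2zU : Prop :=
  ∃ Λ : ℝ, 0 < Λ ∧ ∀ (C : ℝ) (u : ℝ → E3 → E3), IsTypeIAncientMild C u →
    (∀ t < 0, TubeExt (u t) (Λ * Real.sqrt (-t)) (C / Real.sqrt (-t))) → ∀ t < 0, ∀ x, u t x = 0

/-- Row A2zE · ENTIRE SLICES (OPEN, typed): space-entire singularity models are trivial. -/
@[conjecture] def Row_A2zE : Prop :=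
  ∀ (C : ℝ) (u : ℝ → E3 → E3), IsTypeIAncientMild C u → (∀ t < 0, EntireExt (u t)) →
    ∀ t < 0, ∀ x, u t x = 0

/-! ## H. Verdicts -/

/-- **Row A2zp holds** (the meter reading). -/
theorem row_A2zp : Row_A2zp := fun _ hM _ _ hu _ ht h x => strain_le_half_of_tubeExt hu hM ht h x

/-- **Row A2zb holds** (backward-end strip cell). -/
theorem row_A2zb : Row_A2zb := fun _ hM _ _ hu T hT h =>
  SubgridMeter.eq_zero_of_strain_le_half_before hu hT fun t ht x =>
    strain_le_half_of_tubeExt hu hM (by linarith : t < 0) (h t ht) x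

/-- Nesting: the backward-end form implies the strip cell. -/
theorem row_A2zb_imp_A2z1 : Row_A2zb → Row_A2z1 := fun h M hM C u hu hT =>
  h M hM C u hu 0 le_rfl hT

/-- **Row A2z1 holds** (strip cell). -/
theorem row_A2z1 : Row_A2z1 := row_A2zb_imp_A2z1 row_A2zb

/-- **Row A2zg holds** (Gaussian-type cell). -/
theorem row_A2zg : Row_A2zg := fun _ hM _ _ hu h =>
  SubgridMeter.eq_zero_of_strain_le_half hu fun t ht x => strain_le_half_of_gaussExt hu hM ht (h t ht) x

/-- **Row A2zl holds** (the tube law of the class; tree theorem, fields matched). -/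
theorem row_A2zl : Row_A2zl := fun C u hu _ ht => tube_law C u hu ht

/-- Nesting: the entire cell decides the Gaussian-type cell (with ANY type). -/
theorem row_A2zE_imp : Row_A2zE → Row_A2zg := fun h _ _ C u hu hg =>
  h C u hu fun t ht => EntireExt.of_gaussExt (hg t ht)

/-- (L′) decides every cell (informational). -/
theorem rows_of_L' (hL : ∀ (C : ℝ) (u : ℝ → E3 → E3), IsTypeIAncientMild C u → ∀ t < 0, ∀ x, u t x = 0) :
    Row_A2zU ∧ Row_A2zE :=
  ⟨⟨1, one_pos, fun C u hu _ => hL C u hu⟩, fun C u hu _ => hL C u hu⟩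

/-! ## I. REV 2 — the QUANTIFIED tube law and the two-sided window

The tree's `exists_tube_extension_of_typeI_ancient_mild` hides Guberović's constants behind `∃ r > 0, ∃ B`.
Replaying its proof with the bookkeeping kept (datum at `s' = s − τ`, `τ = (−s)/(2c₀²C_b²)`, `C_b = max C 1`,
datum amplitude `M = C_b/√(−s)`, radius `c₀⁻¹√τ`, bound `c₀M`) gives the QUANTIFIED law: every slice `u s`
of every `u ∈ A_C` extends holomorphically to the tube of width `√(−s)/(2c₀²C_b)` with complex amplitude
`c₀C_b/√(−s)`, `c₀ > 1` the absolute constant of `guberovic2010_analyticity_radius`.  Combined with the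
strip cell (`Row_A2z1` at `M = c₀C_b`) this pins, for a NONZERO element, the width of analyticity at
that amplitude into a window of pure-number dynamic range: at every time it is `≥ √(−t)/(2c₀²C_b)`, and
it is NOT `≥ (8c₀C_b+1)√(−t)` at every time. -/

-- `sqrt_two_le_two`: `√2 ≤ 2` restates a landed Literature lemma (gate lint dedup.landed, twin `Literature.Barriers.CriticalPhenomena.HierarchicalRG.sqrt_two_le_two`); not re-declared — its one use carries the line's own one-line proof inline (port edit, proof text only).

/-- **Quantified tube law (PROVED; Guberović 2010 / BGK 2016 Thm 2.4.1 restarted on the class, constants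
kept).** -/
theorem tube_law_quantified : ∃ c₀ : ℝ, 1 < c₀ ∧
    ∀ (C : ℝ) (u : ℝ → E3 → E3), IsTypeIAncientMild C u → ∀ s < 0,
      TubeExt (u s) (Real.sqrt (-s) / (2 * c₀ ^ 2 * max C 1)) (c₀ * max C 1 / Real.sqrt (-s)) := by
  obtain ⟨c₀, hc₀, hG⟩ := guberovic2010_analyticity_radius_holds.of_oseen_solution
  refine ⟨c₀, hc₀, fun C u hu s hs => ?_⟩
  have hc₀0 : 0 < c₀ := one_pos.trans hc₀
  have hTI : HasTypeITimeDecay C u := hu.hasTypeITimeDecay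
  have hcont : ContinuousOn (uncurry u) (Iio (0 : ℝ) ×ˢ univ) := hu.continuousOn_uncurry
  have hmild : ∀ s t : ℝ, s < t → t < 0 → ∀ x,
      u t x = UnboundedOperators.heatExtension (u s) (t - s) x - oseenDuhamel 1 s u u t x :=
    fun s t hst ht x => hu.mild_eq_heatExtension hst ht x
  have hdiv : ∀ t < 0, VectorCalculus.IsDivFree (u t) := fun t ht => hu.isDivFree ht
  have hC1 : ∀ t < 0, ContDiff ℝ 1 (u t) := fun t ht => (hu.contDiff_slice ht).of_le (by norm_cast)
  -- slices are continuous
  have hslice : ∀ t < 0, Continuous (u t) := fun t ht =>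
    hcont.comp_continuous (Continuous.prodMk_right t) fun x => ⟨ht, mem_univ _⟩
  have hC0 : 0 ≤ C := hu.nonneg
  -- constants (as in the tree proof)
  set Cb : ℝ := max C 1 with hCb
  have hCb1 : 1 ≤ Cb := le_max_right _ _
  have hCb0 : 0 < Cb := one_pos.trans_le hCb1
  have hCCb : C ≤ Cb := le_max_left _ _
  have hms : 0 < -s := neg_pos.2 hs
  set M : ℝ := Cb / Real.sqrt (-s) with hM
  have hsq : 0 < Real.sqrt (-s) := Real.sqrt_pos.2 hms
  have hM0 : 0 < M := div_pos hCb0 hsq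
  set τ : ℝ := (-s) / (2 * c₀ ^ 2 * Cb ^ 2) with hτ
  have hτ0 : 0 < τ := by positivity
  have hc2 : 1 ≤ c₀ ^ 2 * Cb ^ 2 := one_le_mul_of_one_le_of_one_le (one_le_pow₀ hc₀.le) (one_le_pow₀ hCb1)
  have hτle : τ ≤ (-s) / 2 := by
    rw [hτ, div_le_div_iff₀ (by positivity) two_pos]
    nlinarith
  set s' : ℝ := s - τ with hs'
  set T₁ : ℝ := s + τ / 2 with hT₁
  have hs's : s' < s := by rw [hs']; linarith
  have hT₁0 : T₁ < 0 := by rw [hT₁]; linarith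
  have hsT₁ : s < T₁ := by rw [hT₁]; linarith
  have hs'0 : s' < 0 := hs's.trans hs
  have hwin : T₁ ≤ s' + 1 / (c₀ ^ 2 * M ^ 2) := by
    have e : 1 / (c₀ ^ 2 * M ^ 2) = 2 * τ := by
      rw [hM, hτ, div_pow, Real.sq_sqrt hms.le]
      field_simp
    rw [e, hT₁, hs']
    linarith
  -- the datum `a = u s'`
  have ha_meas : AEStronglyMeasurable (u s') volume := (hslice s' hs'0).aestronglyMeasurable
  have ha_bd : ∀ x, ‖u s' x‖ ≤ M := by
    intro x
    refine (hTI s' hs'0 x).trans ?_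
    rw [hM]
    have h1 : Real.sqrt (-s) ≤ Real.sqrt (-s') := Real.sqrt_le_sqrt (by linarith)
    calc C / Real.sqrt (-s') ≤ Cb / Real.sqrt (-s') := div_le_div_of_nonneg_right hCCb (hsq.trans_le h1).le
      _ ≤ Cb / Real.sqrt (-s) := div_le_div_of_nonneg_left hCb0.le hsq h1
  have ha_Linf : eLpNorm (u s') ∞ volume ≤ ENNReal.ofReal M := by
    rw [eLpNorm_exponent_top]
    exact eLpNormEssSup_le_of_ae_bound (Eventually.of_forall ha_bd)
  have ha_div : IsWeaklyDivFree (u s') :=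
    VectorCalculus.IsDivFree.isWeaklyDivFree_holds (hdiv s' hs'0) (hC1 s' hs'0)
  -- `w = u` on the window
  have hw_meas : AEStronglyMeasurable (uncurry u)
      ((volume : Measure (ℝ × EuclideanSpace ℝ (Fin 3))).restrict (Ioo s' T₁ ×ˢ univ)) := by
    refine (hcont.mono (prod_mono (fun t ht => ?_) Subset.rfl)).aestronglyMeasurable
      (measurableSet_Ioo.prod MeasurableSet.univ)
    exact (ht.2.trans hT₁0 : t < 0)
  have hM' : 0 ≤ C / Real.sqrt (-T₁) := div_nonneg hC0 (Real.sqrt_nonneg _)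
  have hw_bd : ∀ t ∈ Ioo s' T₁, eLpNorm (u t) ∞ volume ≤ ENNReal.ofReal (C / Real.sqrt (-T₁)) := by
    intro t ht
    have ht0 : t < 0 := ht.2.trans hT₁0
    rw [eLpNorm_exponent_top]
    refine eLpNormEssSup_le_of_ae_bound (Eventually.of_forall fun x => (hTI t ht0 x).trans ?_)
    have hT : 0 < Real.sqrt (-T₁) := Real.sqrt_pos.2 (neg_pos.2 hT₁0)
    exact div_le_div_of_nonneg_left hC0 hT (Real.sqrt_le_sqrt (by linarith [ht.2]))
  have hw_eq : ∀ t ∈ Ioo s' T₁, u t =ᵐ[volume] fun x =>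
      UnboundedOperators.heatExtension (u s') (1 * (t - s')) x - oseenDuhamel 1 s' u u t x := by
    intro t ht
    rw [one_mul]
    exact Eventually.of_forall fun x => hmild s' t ht.1 (ht.2.trans hT₁0) x
  have hw_cont : ∀ t ∈ Ioo s' T₁, Continuous (u t) := fun t ht => hslice t (ht.2.trans hT₁0)
  -- Guberović's theorem on the window, evaluated at `t = s`
  obtain ⟨U, hUd, hUv, hUb⟩ := hG one_pos s' hM0 ha_meas ha_Linf ha_div (hs's.trans hsT₁) hwin hM'
    hw_meas hw_bd hw_eq hw_cont s ⟨hs's, hsT₁⟩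
  have hT : TubeExt (u s) (c₀⁻¹ * Real.sqrt (1 * (s - s'))) (c₀ * M) := ⟨U, hUd, hUv, hUb⟩
  -- bookkeeping: `c₀⁻¹ √τ = √(−s)/(√2 c₀² C_b) ≥ √(−s)/(2 c₀² C_b)` and `c₀ M = c₀ C_b/√(−s)`
  refine hT.mono ?_ (le_of_eq ?_)
  · have e1 : 1 * (s - s') = τ := by rw [hs']; ring
    have h2 : (0 : ℝ) < Real.sqrt 2 := Real.sqrt_pos.2 two_pos
    have e2 : Real.sqrt τ = Real.sqrt (-s) / (Real.sqrt 2 * c₀ * Cb) := by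
      have hden : (2 * c₀ ^ 2 * Cb ^ 2 : ℝ) = (Real.sqrt 2 * c₀ * Cb) ^ 2 := by
        rw [mul_pow, mul_pow, Real.sq_sqrt (show (0:ℝ) ≤ 2 by norm_num)]
      rw [hτ, hden, Real.sqrt_div' _ (sq_nonneg _), Real.sqrt_sq (by positivity)]
    rw [e1, e2]
    have e3 : c₀⁻¹ * (Real.sqrt (-s) / (Real.sqrt 2 * c₀ * Cb)) = Real.sqrt (-s) / (Real.sqrt 2 * c₀ ^ 2 * Cb) := by
      field_simp
    rw [e3]
    exact div_le_div_of_nonneg_left (Real.sqrt_nonneg _) (by positivity)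
      (by nlinarith [(show Real.sqrt 2 ≤ 2 by nlinarith [Real.sqrt_nonneg 2, Real.sq_sqrt (show (0:ℝ) ≤ 2 by norm_num)]), mul_pos (pow_pos hc₀0 2) hCb0])
  · rw [hM, mul_div_assoc]

/-- The quantified law recovers the unquantified tree law `Row_A2zl` (positivity of the width). -/
theorem tube_law_of_quantified {c₀ : ℝ} (hc₀ : 1 < c₀)
    (h : ∀ (C : ℝ) (u : ℝ → E3 → E3), IsTypeIAncientMild C u → ∀ s < 0,
      TubeExt (u s) (Real.sqrt (-s) / (2 * c₀ ^ 2 * max C 1)) (c₀ * max C 1 / Real.sqrt (-s)))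
    (C : ℝ) (u : ℝ → E3 → E3) (hu : IsTypeIAncientMild C u) {t : ℝ} (ht : t < 0) :
    ∃ r : ℝ, 0 < r ∧ ∃ B : ℝ, TubeExt (u t) r B := by
  have hc₀0 : 0 < c₀ := one_pos.trans hc₀
  have hCb0 : 0 < max C 1 := one_pos.trans_le (le_max_right _ _)
  exact ⟨_, by have := Real.sqrt_pos.2 (neg_pos.2 ht); positivity, _, h C u hu t ht⟩

/-! ### Rows of REV 2 -/

/-- Row A2zq · QUANTIFIED TUBE LAW (PROVED; calibration, in print: Guberović 2010 / BGK 2016 Thm 2.4.1 with the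
constants kept): width `√(−t)/(2c₀² max(C,1))` at complex amplitude `c₀ max(C,1)/√(−t)`, one absolute `c₀ > 1`. -/
def Row_A2zq : Prop :=
  ∃ c₀ : ℝ, 1 < c₀ ∧ ∀ (C : ℝ) (u : ℝ → E3 → E3), IsTypeIAncientMild C u → ∀ t < 0,
    TubeExt (u t) (Real.sqrt (-t) / (2 * c₀ ^ 2 * max C 1)) (c₀ * max C 1 / Real.sqrt (-t))

/-- Row A2zw · TWO-SIDED WINDOW (PROVED): for a NONZERO element of `A_C` the width of analyticity at complex
amplitude `c₀C_b/√(−t)` (`C_b = max(C,1)`) is at least `√(−t)/(2c₀²C_b)` at EVERY time and is NOT at least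
`(8c₀C_b+1)√(−t)` at every time — a window of pure-number dynamic range `2c₀²C_b(8c₀C_b+1)`. -/
def Row_A2zw : Prop :=
  ∃ c₀ : ℝ, 1 < c₀ ∧ ∀ (C : ℝ) (u : ℝ → E3 → E3), IsTypeIAncientMild C u → (∃ t < 0, ∃ x, u t x ≠ 0) →
    (∀ t < 0, TubeExt (u t) (Real.sqrt (-t) / (2 * c₀ ^ 2 * max C 1)) (c₀ * max C 1 / Real.sqrt (-t))) ∧
    ¬ (∀ t < 0, TubeExt (u t) ((8 * (c₀ * max C 1) + 1) * Real.sqrt (-t)) (c₀ * max C 1 / Real.sqrt (-t)))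

/-- **Row A2zq holds** (the quantified tube law). -/
theorem row_A2zq : Row_A2zq := tube_law_quantified

/-- Nesting: the quantified law gives back the tree law. -/
theorem row_A2zq_imp_A2zl : Row_A2zq → Row_A2zl := fun hq C u hu _ ht => by
  obtain ⟨_, hc₀, h⟩ := hq
  exact tube_law_of_quantified hc₀ h C u hu ht

/-- The window: lower edge = `Row_A2zq`, upper edge = the strip cell `Row_A2z1` at `M = c₀ max(C,1)`. -/
theorem row_A2zw_of (hq : Row_A2zq) (h1 : Row_A2z1) : Row_A2zw := by
  obtain ⟨c₀, hc₀, h⟩ := hq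
  refine ⟨c₀, hc₀, fun C u hu hne => ⟨fun t ht => h C u hu t ht, fun hall => ?_⟩⟩
  obtain ⟨t, ht, x, hx⟩ := hne
  have hM : 0 ≤ c₀ * max C 1 := by
    have := one_pos.trans hc₀
    positivity
  exact hx (h1 (c₀ * max C 1) hM C u hu hall t ht x)

/-- **Row A2zw holds** (the two-sided window). -/
theorem row_A2zw : Row_A2zw := row_A2zw_of row_A2zq row_A2z1

/-- (L′) decides the window row too (vacuously: no nonzero element) — informational. -/
theorem row_A2zw_of_L' (hL : ∀ (C : ℝ) (u : ℝ → E3 → E3), IsTypeIAncientMild C u → ∀ t < 0, ∀ x, u t x = 0) :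
    Row_A2zw :=
  ⟨2, by norm_num, fun C u hu hne => by
    obtain ⟨t, ht, x, hx⟩ := hne
    exact absurd (hL C u hu t ht x) hx⟩

end Summit.NavierStokesRegularity.NavierStokesRegularity.Theorems.ScenarioCensus.StripMeter

namespace Summit.NavierStokesRegularity.NavierStokesRegularity.Theorems.ScenarioCensus

/-! ## Census KEYS (ns `…Theorems.ScenarioCensus`): instrument STRIP METER (block A2) — TREE-decided cells A2zp / A2z1 / A2zb / A2zg / A2zl / A2zq / A2zw, OPEN rows A2zU / A2zE -/

/-- **Cell A2zp** (METER READING, pointwise law: tube width `(8M+1)√(−t)` at complex amplitude `M/√(−t)` ⇒ `(−t)‖∇u(t,x)‖ ≤ ½`): `:= StripMeter.Row_A2zp`. DECIDED. -/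
def Row_A2zp : Prop := StripMeter.Row_A2zp
/-- A2zp is EXCLUDED (decided in the tree): `StripMeter.row_A2zp`. -/
theorem row_A2zp_excluded : Row_A2zp := StripMeter.row_A2zp

/-- **Cell A2z1** (STRIP CELL, every `M ≥ 0`: analytic in that tube at all times ⇒ `u ≡ 0`): `:= StripMeter.Row_A2z1`. DECIDED. -/
def Row_A2z1 : Prop := StripMeter.Row_A2z1
/-- A2z1 is EXCLUDED (decided in the tree): `StripMeter.row_A2z1`. -/
theorem row_A2z1_excluded : Row_A2z1 := StripMeter.row_A2z1

/-- **Cell A2zb** (backward-end form of A2z1): `:= StripMeter.Row_A2zb`. DECIDED. -/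
def Row_A2zb : Prop := StripMeter.Row_A2zb
/-- A2zb is EXCLUDED (decided in the tree): `StripMeter.row_A2zb`. -/
theorem row_A2zb_excluded : Row_A2zb := StripMeter.row_A2zb

/-- **Cell A2zg** (GAUSSIAN-TYPE entire slices, `θ = 144M² + 1` ⇒ `u ≡ 0`): `:= StripMeter.Row_A2zg`. DECIDED. -/
def Row_A2zg : Prop := StripMeter.Row_A2zg
/-- A2zg is EXCLUDED (decided in the tree): `StripMeter.row_A2zg`. -/
theorem row_A2zg_excluded : Row_A2zg := StripMeter.row_A2zg

/-- **Row A2zl** (TUBE LAW of the class = the tree theorem `exists_tube_extension_of_typeI_ancient_mild`, fields matched; a tree fact, not a new cell): `:= StripMeter.Row_A2zl`. PROVED. -/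
def Row_A2zl : Prop := StripMeter.Row_A2zl
/-- A2zl is EXCLUDED (decided in the tree): `StripMeter.row_A2zl`. -/
theorem row_A2zl_excluded : Row_A2zl := StripMeter.row_A2zl

/-- **Cell A2zq** (REV 2 · QUANTIFIED TUBE LAW: width `√(−t)/(2c₀² max(C,1))` at complex amplitude `c₀ max(C,1)/√(−t)`, one absolute `c₀ > 1`): `:= StripMeter.Row_A2zq`. DECIDED. -/
def Row_A2zq : Prop := StripMeter.Row_A2zq
/-- A2zq is EXCLUDED (decided in the tree): `StripMeter.row_A2zq`. -/
theorem row_A2zq_excluded : Row_A2zq := StripMeter.row_A2zq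

/-- **Cell A2zw** (REV 2 · TWO-SIDED WINDOW for a nonzero element of `A_C`): `:= StripMeter.Row_A2zw`. DECIDED. -/
def Row_A2zw : Prop := StripMeter.Row_A2zw
/-- A2zw is EXCLUDED (decided in the tree): `StripMeter.row_A2zw`. -/
theorem row_A2zw_excluded : Row_A2zw := StripMeter.row_A2zw

/-- **Row A2zU** (UNIVERSAL WIDTH at class amplitude) — typed only: `:= StripMeter.Row_A2zU`. OPEN (no witness, no proof). -/
@[conjecture] def Row_A2zU : Prop := StripMeter.Row_A2zU

/-- **Row A2zE** (ENTIRE SLICES ⇒ trivial) — typed only: `:= StripMeter.Row_A2zE`. OPEN (no witness, no proof). -/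
@[conjecture] def Row_A2zE : Prop := StripMeter.Row_A2zE

/-- Lattice edges at key level: A2zb → A2z1 (`StripMeter.row_A2zb_imp_A2z1`), A2zE → A2zg (`row_A2zE_imp`), A2zq → A2zl (`row_A2zq_imp_A2zl`). -/
theorem row_A2z1_of_row_A2zb : Row_A2zb → Row_A2z1 := StripMeter.row_A2zb_imp_A2z1
/-- See `row_A2z1_of_row_A2zb`. -/
theorem row_A2zg_of_row_A2zE : Row_A2zE → Row_A2zg := StripMeter.row_A2zE_imp
/-- See `row_A2z1_of_row_A2zb`. -/
theorem row_A2zl_of_row_A2zq : Row_A2zq → Row_A2zl := StripMeter.row_A2zq_imp_A2zl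

end Summit.NavierStokesRegularity.NavierStokesRegularity.Theorems.ScenarioCensus

end
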